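import Mathlib
import HarnessLib
import Summits.HubbardSuperconductivity.HubbardSuperconductivity.Theorems.KLProgrammeKLRegimeEnginePartitionFnUnits
import Summits.HubbardSuperconductivity.HubbardSuperconductivity.Theorems.KLProgrammeKLRegimeEngineV8E5BlockTrivial

/-!
# Route `KLProgramme` — crux K3 ENGINE (stmt-HubbardSuperconductivity-20437 `KLRegimeEngineV17F2`), stub (b) v2 / class #3 (E.5 share):
# «(Z) along the blocks», THE TRIVIAL-FAMILY STEP — block `0`'s first slice `(Λ_1, Λ_0]` and the E.5 share's small-`n` branches
# (cell gate-hubbard-kl, seat gate-hubbard-kl-p5 g13; sibling of `…EnginePartitionFnUnits` §3/§4 and `…EngineScaleZeroPartitionFnUnit`)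

The first slice of block `0` (`𝒱_0 ↦ 𝒱_1`, covariance `C^K_{(Λ_1,Λ_0]}`) lies outside every thin plateau (E1-LEVELS-BLUEPRINT-g8 §1 (β): «split block 0 as
slice 1 with the TRIVIAL one-sector input family `trivialMultiplier` — all plateau hypotheses trivial — + slices 2..d with input family `F_0`»); likewise the
E.5 share's steps `n ≤ 2` run through `trivialMultiplier` (…EngineV8E5BlockTrivial, …E5CarrierDoorsTrivialInput).  With `F = F̃ = trivialMultiplier` the plateau
hypotheses of `isUnit_effPartitionFn_of_plateau_wt` / `_prescribed` are automatic (`trivialMultiplier_mul_self`, `sum_trivialMultiplier`,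
`trivialMultiplier_eq_zero_of_sum_eq_zero`), for ANY covariance `C`:

* §1 `isUnit_effPartitionFn_trivialFamily_wt` / `isUnit_effPartitionFn_trivialFamily_prescribed` — `∫dμ_C e^{−G}` is a unit from the trivial-family door data
  (Gram constant `κ` of `S(1)ᵀ C S(1)`, (weighted) row/column sums `≤ α`, (weighted / prescribed) input sizes of `G` read through `E(1)`, `ρ`, `θ < 1`);
* §2 `hubbardEffPartitionFnCT_klScale_ne_zero_of_trivialStep_wt` / `_prescribed` — on the kl-grid: `Z^K_{Λ_{J₁}} ≠ 0` and the trivial-family door data for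
  `G := 𝒱_{J₁}[K]`, `C := C^K_{(Λ_{J₂},Λ_{J₁}]}` `⇒ Z^K_{Λ_{J₂}} ≠ 0` (block `0` slice `1`: `J₁ = 0`, `J₂ = 1`, with `Z^K_{Λ_0} ≠ 0` from
  `hubbardEffPartitionFnCT_scaleZero_ne_zero_frame_U10L4`); slices `2..d` of block `0` are `isUnit_effPartitionFn_blockStep_wt/_lev` at `J₁ = 1`.
Everything is proved; no definitions, no named facts, no sorry; nothing asserts superconductivity.
References: BGM 2006 §2.3 (2.13)–(2.14), §2.7 (2.70), §3 (3.2)–(3.8) [cite: BenfattoGiulianiMastropietro2006].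
-/

noncomputable section

namespace Summit.HubbardSuperconductivity.HubbardSuperconductivity.Theorems.EngineV8

set_option linter.dupNamespace false -- summit = problem name (single-conjunct summit), D-0017

open Real Finset Literature.MathematicalPhysics.QuantumLattice Literature.Probability.LatticeModels GrassmannAlgebra
open Summit.HubbardSuperconductivity.HubbardSuperconductivity.Theorems.KLProgrammeLegKernels
open Summit.HubbardSuperconductivity.HubbardSuperconductivity.Theorems.KLRegimeSplit
open Literature.Probability.LatticeModels.BattleFederbush

variable {L M : ℕ} [NeZero L] [NeZero M] {Lab : Type*} [DecidableEq Lab] {wt : Finset Lab → ℝ}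

/-! ## §1 Any covariance, trivial one-sector family -/

/-- **THE STEP PARTITION FUNCTION IS A UNIT THROUGH THE TRIVIAL FAMILY, WEIGHTED CURRENCY** — any covariance `C`, any even `G` without constant part:
Gram constant `κ` of `S(1)ᵀ C S(1)`, weighted row/column sums `≤ α`, weighted input sizes `B m′` of `map (toLin' E(1)) G`, `ρ`, `θ < 1` (profile
`m′ ↦ ε_x^{2m′} B m′`) `⇒ IsUnit ∫dμ_C e^{−G}`. -/
theorem isUnit_effPartitionFn_trivialFamily_wt (hwt : IsTreeWeight wt) (πl : SpaceTimeIdx L M × SectorLeg 1 → Lab) {β : ℝ} (hβ : 0 < β)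
    (G : HubbardGrassmann L M) (hG : G ∈ evenPart ℂ (HubbardFieldIdx L M)) (hG0 : constPart ℂ G = 0)
    (C : Matrix (HubbardFieldIdx L M) (HubbardFieldIdx L M) ℂ) {κ : ℝ} (hκ : 0 < κ)
    (hGB : IsGramBoundedR ((sectorSubMatrix L M β (trivialMultiplier L M)).transpose * C * sectorSubMatrix L M β (trivialMultiplier L M)) κ)
    (B : ℕ → ℝ) (hB0 : ∀ m', 0 ≤ B m')
    (hB : ∀ (m' : ℕ) (j : Fin (2 * m')) (w : SpaceTimeIdx L M × SectorLeg 1),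
      ∑ Y ∈ univ.filter (fun Y : Fin (2 * m') → SpaceTimeIdx L M × SectorLeg 1 => Y j = w),
        wt ((univ.image Y).image πl) * ‖kernel ℂ (ExteriorAlgebra.map (Matrix.toLin' (sectorAnalysisMatrix L M β (trivialMultiplier L M))) G) (2 * m') Y‖ ≤
          B m')
    {α : ℝ} (hα : 0 < α)
    (hrow : ∀ X, ∑ Y, ‖((sectorSubMatrix L M β (trivialMultiplier L M)).transpose * C * sectorSubMatrix L M β (trivialMultiplier L M)) X Y‖ *
      wt {πl X, πl Y} ≤ α)
    (hcol : ∀ Y, ∑ X, ‖((sectorSubMatrix L M β (trivialMultiplier L M)).transpose * C * sectorSubMatrix L M β (trivialMultiplier L M)) X Y‖ *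
      wt {πl X, πl Y} ≤ α)
    {ρ : ℝ} (hρ : 0 < ρ)
    (hθ : Real.exp 1 * α * normV (SpaceTimeIdx L M × SectorLeg 1) κ ρ (fun m' => imagTimeWeight β M ^ (2 * m') * B m') / κ ^ 2 < 1) :
    IsUnit (effPartitionFn ℂ C G) :=
  isUnit_effPartitionFn_of_plateau_wt hwt πl hβ (trivialMultiplier L M) (trivialMultiplier L M) trivialMultiplier_mul_self
    trivialMultiplier_eq_zero_of_sum_eq_zero G hG hG0 C (fun _ _ _ => ⟨sum_trivialMultiplier _, sum_trivialMultiplier _⟩) hκ hGB B hB0 hB hα hrow hcol hρ hθ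

/-- **THE STEP PARTITION FUNCTION IS A UNIT THROUGH THE TRIVIAL FAMILY, PRESCRIBED CURRENCY** — any covariance `C`, any even `G` without constant part:
Gram constant `κ` of `S(1)ᵀ C S(1)`, row/column sums `≤ α`, prescribed input sizes `B m′ Fc` of `G` through `trivialMultiplier` (the raw text of the `(b)₀` /
`(L1)₀` rows), `ρ`, `θ < 1` (profile `m′ ↦ ρc^0·(ε_x·B m′ 0)`) `⇒ IsUnit ∫dμ_C e^{−G}`. -/
theorem isUnit_effPartitionFn_trivialFamily_prescribed {β : ℝ} (hβ : 0 < β)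
    (G : HubbardGrassmann L M) (hG : G ∈ evenPart ℂ (HubbardFieldIdx L M)) (hG0 : constPart ℂ G = 0)
    (C : Matrix (HubbardFieldIdx L M) (HubbardFieldIdx L M) ℂ) {κ : ℝ} (hκ : 0 < κ)
    (hGB : IsGramBoundedR ((sectorSubMatrix L M β (trivialMultiplier L M)).transpose * C * sectorSubMatrix L M β (trivialMultiplier L M)) κ)
    (B : ℕ → ℕ → ℝ) (hB0 : ∀ m' Fc, 0 ≤ B m' Fc)
    (hB : ∀ (m' Fc : ℕ) (E : Finset (Fin (2 * m' + 1 + 1))) (τ : Fin (2 * m' + 1 + 1) → SectorLeg 1) (q : Fin (2 * m' + 1 + 1)),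
      q ∈ E → E.card = Fc + 1 → ∀ y : SpaceTimeIdx L M,
        imagTimeWeight β M ^ (2 * m' + 1) *
          ∑ σ ∈ univ.filter (fun σ : Fin (2 * m' + 1 + 1) → SectorLeg 1 => ∀ e ∈ E, σ e = τ e),
            ∑ x ∈ univ.filter (fun x : Fin (2 * m' + 1 + 1) → SpaceTimeIdx L M => x q = y),
              ‖sectorisedKernel L M β (trivialMultiplier L M) G (2 * m' + 1 + 1) σ x‖ ≤ B (m' + 1) Fc)
    {α : ℝ} (hα : 0 < α)
    (hrow : ∀ X, ∑ Y, ‖((sectorSubMatrix L M β (trivialMultiplier L M)).transpose * C * sectorSubMatrix L M β (trivialMultiplier L M)) X Y‖ ≤ α)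
    (hcol : ∀ Y, ∑ X, ‖((sectorSubMatrix L M β (trivialMultiplier L M)).transpose * C * sectorSubMatrix L M β (trivialMultiplier L M)) X Y‖ ≤ α)
    {ρ : ℝ} (hρ : 0 < ρ) {ρc : ℝ}
    (hθ : Real.exp 1 * α * normV (SpaceTimeIdx L M × SectorLeg 1) κ ρ (fun m' => ρc ^ 0 * (imagTimeWeight β M * B m' 0)) / κ ^ 2 < 1) :
    IsUnit (effPartitionFn ℂ C G) :=
  isUnit_effPartitionFn_of_plateau_prescribed hβ (trivialMultiplier L M) (trivialMultiplier L M) trivialMultiplier_mul_self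
    trivialMultiplier_eq_zero_of_sum_eq_zero G hG hG0 C (fun _ _ _ => ⟨sum_trivialMultiplier _, sum_trivialMultiplier _⟩) hκ hGB B hB0 hB hα hrow hcol hρ hθ

/-! ## §2 On the kl-grid: block `0`'s first slice and the small-`n` steps -/

/-- **`Z^K_{Λ_{J₂}} ≠ 0` FROM `Z^K_{Λ_{J₁}} ≠ 0` THROUGH THE TRIVIAL-FAMILY STEP, weighted track** (block `0` slice `1`: `J₁ = 0`, `J₂ = 1`): the input
`G := 𝒱_{J₁}[K] = klEffectiveAction … J₁` is even (`klEffectiveAction_mem_evenPart`) and without constant part (`Z^K_{Λ_{J₁}} ≠ 0`); the door data as in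
`isUnit_effPartitionFn_trivialFamily_wt` at `C := C^K_{(Λ_{J₂},Λ_{J₁}]}`. -/
theorem hubbardEffPartitionFnCT_klScale_ne_zero_of_trivialStep_wt (hwt : IsTreeWeight wt) (πl : SpaceTimeIdx L M × SectorLeg 1 → Lab) {β : ℝ} (hβ : 0 < β)
    (U μ : ℝ) (K : TrigPolyC4v) {J₁ : ℕ} (J₂ : ℕ) (hZ : hubbardEffPartitionFnCT L M β U μ 0 K (klScale klE0 J₁) ≠ 0) {κ : ℝ} (hκ : 0 < κ)
    (hGB : IsGramBoundedR ((sectorSubMatrix L M β (trivialMultiplier L M)).transpose *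
      hubbardCovSliceCT L M β μ 0 K (klScale klE0 J₂) (klScale klE0 J₁) * sectorSubMatrix L M β (trivialMultiplier L M)) κ)
    (B : ℕ → ℝ) (hB0 : ∀ m', 0 ≤ B m')
    (hB : ∀ (m' : ℕ) (j : Fin (2 * m')) (w : SpaceTimeIdx L M × SectorLeg 1),
      ∑ Y ∈ univ.filter (fun Y : Fin (2 * m') → SpaceTimeIdx L M × SectorLeg 1 => Y j = w),
        wt ((univ.image Y).image πl) *
          ‖kernel ℂ (ExteriorAlgebra.map (Matrix.toLin' (sectorAnalysisMatrix L M β (trivialMultiplier L M)))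
            (klEffectiveAction L M β U μ K klE0 J₁)) (2 * m') Y‖ ≤ B m')
    {α : ℝ} (hα : 0 < α)
    (hrow : ∀ X, ∑ Y, ‖((sectorSubMatrix L M β (trivialMultiplier L M)).transpose *
      hubbardCovSliceCT L M β μ 0 K (klScale klE0 J₂) (klScale klE0 J₁) * sectorSubMatrix L M β (trivialMultiplier L M)) X Y‖ * wt {πl X, πl Y} ≤ α)
    (hcol : ∀ Y, ∑ X, ‖((sectorSubMatrix L M β (trivialMultiplier L M)).transpose *
      hubbardCovSliceCT L M β μ 0 K (klScale klE0 J₂) (klScale klE0 J₁) * sectorSubMatrix L M β (trivialMultiplier L M)) X Y‖ * wt {πl X, πl Y} ≤ α)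
    {ρ : ℝ} (hρ : 0 < ρ)
    (hθ : Real.exp 1 * α * normV (SpaceTimeIdx L M × SectorLeg 1) κ ρ (fun m' => imagTimeWeight β M ^ (2 * m') * B m') / κ ^ 2 < 1) :
    hubbardEffPartitionFnCT L M β U μ 0 K (klScale klE0 J₂) ≠ 0 :=
  hubbardEffPartitionFnCT_klScale_ne_zero_of_step β U μ K J₂ hZ
    (isUnit_effPartitionFn_trivialFamily_wt hwt πl hβ _ (klEffectiveAction_mem_evenPart hβ.ne' U μ K klE0 J₁)
      (constPart_klEffectiveAction_eq_zero β U μ K klE0 J₁ hZ) _ hκ hGB B hB0 hB hα hrow hcol hρ hθ)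

/-- **`Z^K_{Λ_{J₂}} ≠ 0` FROM `Z^K_{Λ_{J₁}} ≠ 0` THROUGH THE TRIVIAL-FAMILY STEP, prescribed track** — the same with the prescribed input sizes `B m′ Fc` of
`𝒱_{J₁}[K]` through `trivialMultiplier` (the raw `(b)₀`-type text) and unweighted `α`. -/
theorem hubbardEffPartitionFnCT_klScale_ne_zero_of_trivialStep_prescribed {β : ℝ} (hβ : 0 < β) (U μ : ℝ) (K : TrigPolyC4v) {J₁ : ℕ} (J₂ : ℕ)
    (hZ : hubbardEffPartitionFnCT L M β U μ 0 K (klScale klE0 J₁) ≠ 0) {κ : ℝ} (hκ : 0 < κ)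
    (hGB : IsGramBoundedR ((sectorSubMatrix L M β (trivialMultiplier L M)).transpose *
      hubbardCovSliceCT L M β μ 0 K (klScale klE0 J₂) (klScale klE0 J₁) * sectorSubMatrix L M β (trivialMultiplier L M)) κ)
    (B : ℕ → ℕ → ℝ) (hB0 : ∀ m' Fc, 0 ≤ B m' Fc)
    (hB : ∀ (m' Fc : ℕ) (E : Finset (Fin (2 * m' + 1 + 1))) (τ : Fin (2 * m' + 1 + 1) → SectorLeg 1) (q : Fin (2 * m' + 1 + 1)),
      q ∈ E → E.card = Fc + 1 → ∀ y : SpaceTimeIdx L M,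
        imagTimeWeight β M ^ (2 * m' + 1) *
          ∑ σ ∈ univ.filter (fun σ : Fin (2 * m' + 1 + 1) → SectorLeg 1 => ∀ e ∈ E, σ e = τ e),
            ∑ x ∈ univ.filter (fun x : Fin (2 * m' + 1 + 1) → SpaceTimeIdx L M => x q = y),
              ‖sectorisedKernel L M β (trivialMultiplier L M) (klEffectiveAction L M β U μ K klE0 J₁) (2 * m' + 1 + 1) σ x‖ ≤ B (m' + 1) Fc)
    {α : ℝ} (hα : 0 < α)
    (hrow : ∀ X, ∑ Y, ‖((sectorSubMatrix L M β (trivialMultiplier L M)).transpose *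
      hubbardCovSliceCT L M β μ 0 K (klScale klE0 J₂) (klScale klE0 J₁) * sectorSubMatrix L M β (trivialMultiplier L M)) X Y‖ ≤ α)
    (hcol : ∀ Y, ∑ X, ‖((sectorSubMatrix L M β (trivialMultiplier L M)).transpose *
      hubbardCovSliceCT L M β μ 0 K (klScale klE0 J₂) (klScale klE0 J₁) * sectorSubMatrix L M β (trivialMultiplier L M)) X Y‖ ≤ α)
    {ρ : ℝ} (hρ : 0 < ρ) {ρc : ℝ}
    (hθ : Real.exp 1 * α * normV (SpaceTimeIdx L M × SectorLeg 1) κ ρ (fun m' => ρc ^ 0 * (imagTimeWeight β M * B m' 0)) / κ ^ 2 < 1) :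
    hubbardEffPartitionFnCT L M β U μ 0 K (klScale klE0 J₂) ≠ 0 :=
  hubbardEffPartitionFnCT_klScale_ne_zero_of_step β U μ K J₂ hZ
    (isUnit_effPartitionFn_trivialFamily_prescribed hβ _ (klEffectiveAction_mem_evenPart hβ.ne' U μ K klE0 J₁)
      (constPart_klEffectiveAction_eq_zero β U μ K klE0 J₁ hZ) _ hκ hGB B hB0 hB hα hrow hcol hρ hθ)

end Summit.HubbardSuperconductivity.HubbardSuperconductivity.Theorems.EngineV8

end
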